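import Mathlib

/-!
# Unique products on a window ⇒ no zero divisors supported on that window

The elementary implication behind every "stage U" certificate of the `pub-kaplansky` search:
if every pair of non-empty finite sets `A ⊆ S`, `B ⊆ T` of a magma `G` has a uniquely
represented product (`UniqueMul A B a₀ b₀`), then in the magma algebra `R[G]` over any
semiring `R` without zero divisors there is no zero product `f * g = 0` with `f ≠ 0`, `g ≠ 0`,
`supp f ⊆ S`, `supp g ⊆ T`.  This is the window-restricted form of the classical
"unique-product groups have no zero divisors" (Passman, *The algebraic structure of group rings*,
Ch. 13; recalled in [cite: Gardam2021, §1]); the proof is the one-line coefficient computation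
`(f * g).coeff (a₀ b₀) = f.coeff a₀ · g.coeff b₀` of `MonoidAlgebra.coeff_mul_mul_of_uniqueMul`.

An UNSAT certificate for the CNF "there exist non-empty `A ⊆ S`, `B ⊆ T` all of whose products are
represented at least twice" is exactly a proof of `UniqueProductWindow S T`; this file records what
that buys, over every coefficient domain at once. [folklore]
-/

namespace Literature.Algebra.GroupRings

/-- Every pair of non-empty subsets `A ⊆ S`, `B ⊆ T` has a uniquely represented product. [folklore] -/
def UniqueProductWindow {G : Type*} [Mul G] (S T : Finset G) : Prop :=
  ∀ A ⊆ S, ∀ B ⊆ T, A.Nonempty → B.Nonempty → ∃ a₀ ∈ A, ∃ b₀ ∈ B, UniqueMul A B a₀ b₀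

/-- The whole magma has unique products iff every window does. [folklore] -/
theorem uniqueProductWindow_of_uniqueProds {G : Type*} [Mul G] [UniqueProds G] (S T : Finset G) :
    UniqueProductWindow S T :=
  fun _A _ _B _ hA hB => UniqueProds.uniqueMul_of_nonempty hA hB

/-- Windows are monotone: a certificate for `(S, T)` covers every sub-window. [folklore] -/
theorem UniqueProductWindow.mono {G : Type*} [Mul G] {S S' T T' : Finset G}
    (h : UniqueProductWindow S T) (hS : S' ⊆ S) (hT : T' ⊆ T) : UniqueProductWindow S' T' :=
  fun A hA B hB => h A (hA.trans hS) B (hB.trans hT)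

/-- Unique products on the window `(S, T)` exclude zero divisors supported on it, over any
semiring without zero divisors (in particular over every field). [folklore] -/
theorem UniqueProductWindow.no_zero_divisors {R G : Type*} [Semiring R] [NoZeroDivisors R] [Mul G]
    {S T : Finset G} (h : UniqueProductWindow S T) {f g : MonoidAlgebra R G}
    (hf : f.coeff.support ⊆ S) (hg : g.coeff.support ⊆ T) (hfg : f * g = 0) : f = 0 ∨ g = 0 := by
  by_contra hne
  push Not at hne
  obtain ⟨hf0, hg0⟩ := hne
  have hA : f.coeff.support.Nonempty :=
    Finsupp.support_nonempty_iff.mpr (fun h0 => hf0 (MonoidAlgebra.coeff_eq_zero.mp h0))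
  have hB : g.coeff.support.Nonempty :=
    Finsupp.support_nonempty_iff.mpr (fun h0 => hg0 (MonoidAlgebra.coeff_eq_zero.mp h0))
  obtain ⟨a₀, ha₀, b₀, hb₀, hu⟩ := h _ hf _ hg hA hB
  have key : (f * g).coeff (a₀ * b₀) = f.coeff a₀ * g.coeff b₀ :=
    MonoidAlgebra.coeff_mul_mul_of_uniqueMul hu
  rw [hfg, MonoidAlgebra.coeff_zero, Finsupp.zero_apply] at key
  rcases mul_eq_zero.mp key.symm with h1 | h1
  · exact (Finsupp.mem_support_iff.mp ha₀) h1
  · exact (Finsupp.mem_support_iff.mp hb₀) h1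

/-- Contrapositive, in the shape a SAT model would take: a zero product with non-zero factors
supported on `(S, T)` yields non-empty `A ⊆ S`, `B ⊆ T` with no uniquely represented product.
[folklore] -/
theorem exists_nonUniqueProduct_pair_of_zero_divisor {R G : Type*} [Semiring R] [NoZeroDivisors R]
    [Mul G] {S T : Finset G} {f g : MonoidAlgebra R G} (hf : f.coeff.support ⊆ S)
    (hg : g.coeff.support ⊆ T) (hfg : f * g = 0) (hf0 : f ≠ 0) (hg0 : g ≠ 0) :
    ∃ A ⊆ S, ∃ B ⊆ T, A.Nonempty ∧ B.Nonempty ∧ ∀ a₀ ∈ A, ∀ b₀ ∈ B, ¬ UniqueMul A B a₀ b₀ := by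
  by_contra hno
  push Not at hno
  have hw : UniqueProductWindow S T := fun A hA B hB hAn hBn => hno A hA B hB hAn hBn
  rcases hw.no_zero_divisors hf hg hfg with h1 | h1
  · exact hf0 h1
  · exact hg0 h1

end Literature.Algebra.GroupRings
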